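import Mathlib
import HarnessLib
import Summits.HubbardSuperconductivity.HubbardSuperconductivity.Theorems.KLProgrammeKLRegimeVolumeLimitFlowFramesV17F2
import Summits.HubbardSuperconductivity.HubbardSuperconductivity.Theorems.KLProgrammeKLRegimeCountertermJacksonLowBernstein

/-!
# The flow frames of two volumes agree IN EVERY DERIVATIVE, up to `O_r(1)/L`, FROM THE REV-2 TOWER `klPredsV17F2`

Cell gate-hubbard-kl, seat hubbard-kl-k3c5-p3 (g8; VL lane of crux K3).  Item of record stmt-HubbardSuperconductivity-20440 `KLRegimeVolumeLimitV17F2`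
(«cauchy v8-F2», stub `stub_vl_nestedFramed`, ROUTE A).  `…VolumeLimitFlowFramesV17F2` (g7) proved the SUP agreement `|K_n^{(L,M)}(q) − K_n^{(L′,M′)}(q)| ≤
(Σ_{m<n} Q.CL β m)/L` from the tower; every cross-volume comparison of the one-shot COVARIANCES at scales `n ≥ 1` (Route A step (A4); (E3f-F) STEP(n) of
the engine child) reads the band difference `e_K − e_{K′} = −(K ⊖ K′)` through its lattice-line derivatives, i.e. through `coeffNorm r (K ⊖ K′)`
(p1b's `‖Dʳ evalM A‖ ≤ coeffNorm r A`).  This file gives ALL ORDERS with explicit constants (`d_m = klFlowDeg m = 2⁷·4^m`):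
* §1 `coeffExt_fsub`, `coeffNorm_eq_sum_coeffExt`, `coeffExt_klFlowFrameU` (coefficient algebra: `coeffExt` additive under `⊖`, `K_n = −Σ_{m<n}` pieces);
* §2 `cosMoment_sub`, **`coeffNorm_fsub_jacksonFrame_le`**: `coeffNorm r (𝒥_d F ⊖ 𝒥_d G) ≤ 4(2d+1)(1+4d)^r·sup|F − G|` (Jackson coefficients linear in
  the profile, `|ĵ| ≤ 1/π` `abs_jkerCoeff_le`, finite Bessel `sum_abs_cosMoment_le`);
* §3 **`coeffNorm_fsub_klFlowFrameU_le_sum`** (data level): `C⁴` readings with `sup_θ|ν_m − ν′_m| ≤ δ_m` ⇒ `coeffNorm r (K_n ⊖ K′_n) ≤ Σ_{m<n} 4(2d_m+1)(1+4d_m)^r δ_m`;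
* §4 **`coeffNorm_fsub_klFlowFrameU_le_of_towerV17F2`**: from `TowerP klPredsV17F2 …`, `δ_m = Q.CL β m / L` ((E3f-F), reader's threshold `Mq := Mstar`,
  history = the tower, as in `flowFrames_twoVolume_of_towerV17F2`); corollaries for `‖Dʲ evalM (K_n ⊖ K′_n)‖`, for the difference of the frame functions,
  and the sup form `frameDist_klFlowFrameU_le_of_towerV17F2`;
* §5 `norm_iteratedDeriv_eval_line_le_coeffNorm` (generic: `|∂ₜᵏ A(p + t e_l)| ≤ coeffNorm k A`, the `UVLineBound` currency) and the two-volume instance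
  `abs_iteratedDeriv_line_klFlowFrameU_sub_le_of_towerV17F2`.
At fixed `β` the scales and degrees are fixed, so every bound is `C(β, r)/L → 0`.  Everything is proved; no definition; nothing is asserted about the model.
-/

noncomputable section

namespace Summit.HubbardSuperconductivity.HubbardSuperconductivity.Theorems.TwoPointAssembly

set_option linter.dupNamespace false -- summit = problem name (single-conjunct summit), D-0017

open Real Finset Filter Topology MeasureTheory Literature.MathematicalPhysics.QuantumLattice Literature.Probability.LatticeModels
open Literature.Analysis.Fourier.TrigApprox
open Summit.HubbardSuperconductivity.HubbardSuperconductivity.Theorems.DispersionFlow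
open Summit.HubbardSuperconductivity.HubbardSuperconductivity.Theorems.KLRegimeSplit
open Summit.HubbardSuperconductivity.HubbardSuperconductivity.Theorems.KLProgrammeLegKernels

/-! ## §1 Coefficient algebra of frame differences and of the flow frame -/

/-- **`coeffExt` is additive under `⊖`**: `coeffExt (A ⊖ B) m n = coeffExt A m n − coeffExt B m n` for ALL `m, n`. -/
theorem coeffExt_fsub (A B : TrigPolyC4v) (m n : ℕ) : coeffExt (fsub A B) m n = coeffExt A m n - coeffExt B m n := by
  have hdeg : (fsub A B).degree = max A.degree B.degree := rfl
  by_cases hm : m ≤ max A.degree B.degree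
  · by_cases hn : n ≤ max A.degree B.degree
    · rw [coeffExt_of_le (fsub A B) (hdeg ▸ hm) (hdeg ▸ hn)]
      rfl
    · have hn' : max A.degree B.degree < n := not_le.mp hn
      rw [coeffExt_of_lt_right (fsub A B) (hdeg ▸ hn'), coeffExt_of_lt_right A ((le_max_left _ _).trans_lt hn'),
        coeffExt_of_lt_right B ((le_max_right _ _).trans_lt hn'), sub_zero]
  · have hm' : max A.degree B.degree < m := not_le.mp hm
    rw [coeffExt_of_lt_left (fsub A B) (hdeg ▸ hm'), coeffExt_of_lt_left A ((le_max_left _ _).trans_lt hm'),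
      coeffExt_of_lt_left B ((le_max_right _ _).trans_lt hm'), sub_zero]

/-- **The coefficient weight over any square containing the degree square** (zero-extended coefficients):
`coeffNorm r A = Σ_{m,n ≤ D} (1+m+n)^r |coeffExt A m n|` for `A.degree ≤ D`. -/
theorem coeffNorm_eq_sum_coeffExt (A : TrigPolyC4v) {D : ℕ} (hD : A.degree ≤ D) (r : ℕ) :
    A.coeffNorm r = ∑ m ∈ range (D + 1), ∑ n ∈ range (D + 1), (1 + m + n : ℝ) ^ r * |coeffExt A m n| := by
  unfold TrigPolyC4v.coeffNorm
  have hsub : range (A.degree + 1) ⊆ range (D + 1) := range_mono (by omega)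
  calc ∑ m ∈ range (A.degree + 1), ∑ n ∈ range (A.degree + 1), (1 + m + n : ℝ) ^ r * |A.coeff m n|
      = ∑ m ∈ range (A.degree + 1), ∑ n ∈ range (A.degree + 1), (1 + m + n : ℝ) ^ r * |coeffExt A m n| := by
        refine sum_congr rfl fun m hm => sum_congr rfl fun n hn => ?_
        rw [coeffExt_of_le A (Nat.lt_succ_iff.mp (mem_range.mp hm)) (Nat.lt_succ_iff.mp (mem_range.mp hn))]
    _ = ∑ m ∈ range (A.degree + 1), ∑ n ∈ range (D + 1), (1 + m + n : ℝ) ^ r * |coeffExt A m n| := by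
        refine sum_congr rfl fun m _ => sum_subset hsub fun n hn hn' => ?_
        have : A.degree < n := by simp only [mem_range, not_lt] at hn hn'; omega
        rw [coeffExt_of_lt_right A this, abs_zero, mul_zero]
    _ = ∑ m ∈ range (D + 1), ∑ n ∈ range (D + 1), (1 + m + n : ℝ) ^ r * |coeffExt A m n| := by
        refine sum_subset hsub fun m hm hm' => sum_eq_zero fun n _ => ?_
        have : A.degree < m := by simp only [mem_range, not_lt] at hm hm'; omega
        rw [coeffExt_of_lt_left A this, abs_zero, mul_zero]

section Model

variable (L M : ℕ) [NeZero L] [NeZero M]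

/-- **The flow frame's extended coefficients**: `coeffExt K_n = −Σ_{m<n} coeffExt (klFlowPiece m)` (`K_0 = 0`, `K_{m+1} = K_m ⊖ piece_m`). -/
theorem coeffExt_klFlowFrameU (β U μ : ℝ) (n m' n' : ℕ) :
    coeffExt (klFlowFrameU L M β U μ n) m' n' = -∑ m ∈ range n, coeffExt (klFlowPiece L M β U μ m) m' n' := by
  induction n with
  | zero => simp [klFlowFrameU_zero]
  | succ n ih => rw [klFlowFrameU_succ, coeffExt_fsub, ih, sum_range_succ]; ring

/-- The degree of the scale-`m` flow piece is `2·klFlowDeg m` (a Jackson frame of order `klFlowDeg m`). -/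
theorem klFlowPiece_degree (β U μ : ℝ) (m : ℕ) : (klFlowPiece L M β U μ m).degree = klFlowDeg m + klFlowDeg m := rfl

end Model

/-! ## §2 Two Jackson frames of one degree: the coefficient weight of the difference is linear in `sup |F − G|` -/

section Jackson

variable {F G : (Fin 2 → ℝ) → ℝ}

/-- Continuity of `w ↦ h(w.1, w.2)` on `ℝ × ℝ` for continuous `h`. -/
private theorem continuous_vec2 {h : (Fin 2 → ℝ) → ℝ} (hh : Continuous h) : Continuous fun w : ℝ × ℝ => h ![w.1, w.2] := by
  refine hh.comp (continuous_pi fun i => ?_)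
  fin_cases i <;> simp <;> fun_prop

/-- **The cosine moments are linear in the profile**: `A_{F−G}(k,l) = A_F(k,l) − A_G(k,l)` (continuous `F, G`). -/
theorem cosMoment_sub (hF : Continuous F) (hG : Continuous G) (k l : ℕ) :
    cosMoment (fun p => F p - G p) k l = cosMoment F k l - cosMoment G k l := by
  have hFG : Continuous fun p => F p - G p := hF.sub hG
  have hiF : Integrable (fun w : ℝ × ℝ => cosProd k l w * F ![w.1, w.2]) jmeas :=
    integrable_jmeas_of_continuous ((continuous_cosProd k l).mul (continuous_vec2 hF))
  have hiG : Integrable (fun w : ℝ × ℝ => cosProd k l w * G ![w.1, w.2]) jmeas :=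
    integrable_jmeas_of_continuous ((continuous_cosProd k l).mul (continuous_vec2 hG))
  rw [cosMoment_eq_integral_prod hFG, cosMoment_eq_integral_prod hF, cosMoment_eq_integral_prod hG, ← integral_sub hiF hiG]
  refine integral_congr_ae (Eventually.of_forall fun w => ?_)
  beta_reduce
  ring

/-- **Two Jackson frames of the same degree: `coeffNorm r (𝒥_d F ⊖ 𝒥_d G) ≤ 4(2d+1)(1+4d)^r·δ`** for continuous `F, G` with `|F − G| ≤ δ`
everywhere.  The coefficients of the difference are `ĵ_k ĵ_l A_{F−G}(k,l)` (`cosMoment_sub`), `|ĵ_k| ≤ 1/π` (`abs_jkerCoeff_le`), `(1+k+l)^r ≤ (1+4d)^r`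
on the degree square `k, l ≤ 2d`, and `Σ_{k,l ≤ 2d} |A_{F−G}(k,l)| ≤ 4π²(2d+1)δ` (`sum_abs_cosMoment_le`). -/
theorem coeffNorm_fsub_jacksonFrame_le (d : ℕ) (hF : Continuous F) (hG : Continuous G) {δ : ℝ} (hδ : ∀ p, |F p - G p| ≤ δ) (r : ℕ) :
    (fsub (jacksonFrame d F) (jacksonFrame d G)).coeffNorm r ≤ 4 * (2 * d + 1) * (1 + 4 * d) ^ r * δ := by
  have hδ0 : 0 ≤ δ := (abs_nonneg _).trans (hδ 0)
  set H : (Fin 2 → ℝ) → ℝ := fun p => F p - G p with hH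
  have hHc : Continuous H := hF.sub hG
  have hS := sum_abs_cosMoment_le hHc hδ (d + d)
  have hdeg : (fsub (jacksonFrame d F) (jacksonFrame d G)).degree = d + d := by
    show max (d + d) (d + d) = d + d
    exact max_self _
  unfold TrigPolyC4v.coeffNorm
  rw [hdeg]
  -- the coefficients of the difference inside the degree square
  have hcoef : ∀ m ∈ range (d + d + 1), ∀ n ∈ range (d + d + 1),
      (fsub (jacksonFrame d F) (jacksonFrame d G)).coeff m n = jkerCoeff d m * jkerCoeff d n * cosMoment H m n := by
    intro m hm n hn
    have hm' : m ≤ d + d := Nat.lt_succ_iff.mp (mem_range.mp hm)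
    have hn' : n ≤ d + d := Nat.lt_succ_iff.mp (mem_range.mp hn)
    show coeffExt (jacksonFrame d F) m n - coeffExt (jacksonFrame d G) m n = _
    rw [coeffExt_of_le (jacksonFrame d F) (show m ≤ (jacksonFrame d F).degree from hm') (show n ≤ (jacksonFrame d F).degree from hn'),
      coeffExt_of_le (jacksonFrame d G) (show m ≤ (jacksonFrame d G).degree from hm') (show n ≤ (jacksonFrame d G).degree from hn')]
    show jkerCoeff d m * jkerCoeff d n * cosMoment F m n - jkerCoeff d m * jkerCoeff d n * cosMoment G m n = _
    rw [hH, cosMoment_sub hF hG]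
    ring
  -- termwise bound
  have hterm : ∀ m ∈ range (d + d + 1), ∀ n ∈ range (d + d + 1),
      (1 + m + n : ℝ) ^ r * |(fsub (jacksonFrame d F) (jacksonFrame d G)).coeff m n| ≤
        (1 + 4 * d : ℝ) ^ r * (1 / π ^ 2) * |cosMoment H m n| := by
    intro m hm n hn
    have hm' : m ≤ d + d := Nat.lt_succ_iff.mp (mem_range.mp hm)
    have hn' : n ≤ d + d := Nat.lt_succ_iff.mp (mem_range.mp hn)
    rw [hcoef m hm n hn, abs_mul, abs_mul]
    have h1 : (1 + m + n : ℝ) ^ r ≤ (1 + 4 * d : ℝ) ^ r := by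
      apply pow_le_pow_left₀ (by positivity)
      have : (m : ℝ) ≤ d + d := by exact_mod_cast hm'
      have : (n : ℝ) ≤ d + d := by exact_mod_cast hn'
      linarith
    have hjm := abs_jkerCoeff_le d hm'
    have hjn := abs_jkerCoeff_le d hn'
    have h2 : |jkerCoeff d m| * |jkerCoeff d n| ≤ 1 / π * (1 / π) := mul_le_mul hjm hjn (abs_nonneg _) (by positivity)
    calc (1 + m + n : ℝ) ^ r * (|jkerCoeff d m| * |jkerCoeff d n| * |cosMoment H m n|)
        ≤ (1 + 4 * d : ℝ) ^ r * (1 / π * (1 / π) * |cosMoment H m n|) :=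
          mul_le_mul h1 (mul_le_mul_of_nonneg_right h2 (abs_nonneg _)) (by positivity) (by positivity)
      _ = (1 + 4 * d : ℝ) ^ r * (1 / π ^ 2) * |cosMoment H m n| := by ring
  calc ∑ m ∈ range (d + d + 1), ∑ n ∈ range (d + d + 1), (1 + m + n : ℝ) ^ r * |(fsub (jacksonFrame d F) (jacksonFrame d G)).coeff m n|
      ≤ ∑ m ∈ range (d + d + 1), ∑ n ∈ range (d + d + 1), (1 + 4 * d : ℝ) ^ r * (1 / π ^ 2) * |cosMoment H m n| :=
        sum_le_sum fun m hm => sum_le_sum fun n hn => hterm m hm n hn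
    _ = (1 + 4 * d : ℝ) ^ r * (1 / π ^ 2) * ∑ κ ∈ range (d + d + 1) ×ˢ range (d + d + 1), |cosMoment H κ.1 κ.2| := by
        rw [sum_product, mul_sum]
        exact sum_congr rfl fun m _ => by rw [mul_sum]
    _ ≤ (1 + 4 * d : ℝ) ^ r * (1 / π ^ 2) * (4 * π ^ 2 * ((d + d : ℕ) + 1) * δ) :=
        mul_le_mul_of_nonneg_left hS (by positivity)
    _ = 4 * (2 * d + 1) * (1 + 4 * d) ^ r * δ := by
        have hπ : π ≠ 0 := Real.pi_ne_zero
        field_simp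
        push_cast
        ring

end Jackson

/-! ## §3 Data level: sup-closeness of the readings ⇒ coefficient-weight closeness of the flow frames, every order -/

section Data

variable {L M L' M' : ℕ} [NeZero L] [NeZero M] [NeZero L'] [NeZero M'] {β U μ : ℝ}

/-- A frame function whose `Momentum` lift is `Cᵐ` is continuous. -/
private theorem continuous_of_contDiff_onM_fn'' {P : FrameFn} {m : WithTop ℕ∞} (h : ContDiff ℝ m (onM P)) : Continuous P := by
  have hK : P = fun p : Fin 2 → ℝ => onM P (WithLp.toLp 2 p) := by funext p; simp [onM]
  rw [hK]
  exact h.continuous.comp (PiLp.continuous_toLp 2 _)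

/-- **One scale, two volumes/frames, every order: `coeffNorm r (piece ⊖ piece′) ≤ 4(2d+1)(1+4d)^r · sup_θ|ν − ν′|`** (`d = klFlowDeg m`): the
Jackson piece `𝒥_d(E_μ(ν))` of a `C⁴` reading is, coefficient-wise, Lipschitz in `ν` for the sup norm (`μ ∈ klWindowC`). -/
theorem coeffNorm_fsub_klFlowPieceJackson_le (hμ : μ ∈ klWindowC) {K K' : TrigPolyC4v} (m : ℕ)
    (hc : ContDiff ℝ 4 (fun θ : ℝ => klLocalPart L M β U μ K m θ)) (hc' : ContDiff ℝ 4 (fun θ : ℝ => klLocalPart L' M' β U μ K' m θ))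
    {δ : ℝ} (hδ : ∀ θ, |klLocalPart L M β U μ K m θ - klLocalPart L' M' β U μ K' m θ| ≤ δ) (r : ℕ) :
    (fsub (klFlowPieceJackson L M β U μ m K) (klFlowPieceJackson L' M' β U μ m K')).coeffNorm r ≤
      4 * (2 * klFlowDeg m + 1) * (1 + 4 * klFlowDeg m) ^ r * δ := by
  have hcont : Continuous (klFrameExtFn μ (fun θ : ℝ => klLocalPart L M β U μ K m θ)) :=
    continuous_of_contDiff_onM_fn'' (contDiff_onM_klFrameExtFn hc (klLocalPart_periodic β U μ K m) hμ)
  have hcont' : Continuous (klFrameExtFn μ (fun θ : ℝ => klLocalPart L' M' β U μ K' m θ)) :=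
    continuous_of_contDiff_onM_fn'' (contDiff_onM_klFrameExtFn hc' (klLocalPart_periodic β U μ K' m) hμ)
  exact coeffNorm_fsub_jacksonFrame_le (klFlowDeg m) hcont hcont'
    (fun p => abs_klFrameExtFn_sub_klFrameExtFn_le μ (hc.continuous.intervalIntegrable _ _) (hc'.continuous.intervalIntegrable _ _) hδ p) r

/-- **DATA LEVEL: `coeffNorm r (K_n^{(L,M)} ⊖ K_n^{(L′,M′)}) ≤ Σ_{m<n} 4(2d_m+1)(1+4d_m)^r·δ_m`** from `C⁴` readings at the scales `m < n` in both
volumes with `sup_θ|ν_m − ν′_m| ≤ δ_m` (`d_m = klFlowDeg m`; `K_n = −Σ_{m<n} piece_m` coefficient-wise, `coeffExt_klFlowFrameU`). -/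
theorem coeffNorm_fsub_klFlowFrameU_le_sum (hμ : μ ∈ klWindowC) (n : ℕ)
    (hc : ∀ m < n, ContDiff ℝ 4 (fun θ : ℝ => klLocalPart L M β U μ (klFlowFrameU L M β U μ m) m θ))
    (hc' : ∀ m < n, ContDiff ℝ 4 (fun θ : ℝ => klLocalPart L' M' β U μ (klFlowFrameU L' M' β U μ m) m θ))
    {δ : ℕ → ℝ} (hδ : ∀ m < n, ∀ θ : ℝ,
      |klLocalPart L M β U μ (klFlowFrameU L M β U μ m) m θ - klLocalPart L' M' β U μ (klFlowFrameU L' M' β U μ m) m θ| ≤ δ m)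
    (r : ℕ) :
    (fsub (klFlowFrameU L M β U μ n) (klFlowFrameU L' M' β U μ n)).coeffNorm r ≤
      ∑ m ∈ range n, 4 * (2 * klFlowDeg m + 1) * (1 + 4 * klFlowDeg m) ^ r * δ m := by
  set Pc : ℕ → TrigPolyC4v := fun m => fsub (klFlowPiece L M β U μ m) (klFlowPiece L' M' β U μ m) with hPc
  have hpiece : ∀ m ∈ range n, (Pc m).coeffNorm r ≤ 4 * (2 * klFlowDeg m + 1) * (1 + 4 * klFlowDeg m) ^ r * δ m := by
    intro m hm
    have hm' : m < n := mem_range.mp hm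
    exact coeffNorm_fsub_klFlowPieceJackson_le hμ m (hc m hm') (hc' m hm') (hδ m hm') r
  set A : TrigPolyC4v := fsub (klFlowFrameU L M β U μ n) (klFlowFrameU L' M' β U μ n) with hA
  set D : ℕ := A.degree + ∑ m ∈ range n, (klFlowDeg m + klFlowDeg m) with hD
  have hAD : A.degree ≤ D := Nat.le_add_right _ _
  have hPD : ∀ m ∈ range n, (Pc m).degree ≤ D := by
    intro m hm
    have hdm : (Pc m).degree = klFlowDeg m + klFlowDeg m := by
      show max (klFlowPiece L M β U μ m).degree (klFlowPiece L' M' β U μ m).degree = _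
      rw [klFlowPiece_degree, klFlowPiece_degree, max_self]
    rw [hdm]
    exact (single_le_sum (f := fun m => klFlowDeg m + klFlowDeg m) (fun _ _ => Nat.zero_le _) hm).trans (Nat.le_add_left _ _)
  -- the extended coefficients of `A` are minus the sum of those of the piece differences
  have hext : ∀ m' n', coeffExt A m' n' = -∑ m ∈ range n, coeffExt (Pc m) m' n' := by
    intro m' n'
    rw [hA, coeffExt_fsub, coeffExt_klFlowFrameU, coeffExt_klFlowFrameU]
    simp only [hPc, coeffExt_fsub, sum_sub_distrib]
    ring
  rw [coeffNorm_eq_sum_coeffExt A hAD r]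
  calc ∑ m' ∈ range (D + 1), ∑ n' ∈ range (D + 1), (1 + m' + n' : ℝ) ^ r * |coeffExt A m' n'|
      ≤ ∑ m' ∈ range (D + 1), ∑ n' ∈ range (D + 1), ∑ m ∈ range n, (1 + m' + n' : ℝ) ^ r * |coeffExt (Pc m) m' n'| := by
        refine sum_le_sum fun m' _ => sum_le_sum fun n' _ => ?_
        rw [hext, abs_neg, ← mul_sum]
        exact mul_le_mul_of_nonneg_left (abs_sum_le_sum_abs _ _) (by positivity)
    _ = ∑ m' ∈ range (D + 1), ∑ m ∈ range n, ∑ n' ∈ range (D + 1), (1 + m' + n' : ℝ) ^ r * |coeffExt (Pc m) m' n'| :=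
        sum_congr rfl fun m' _ => sum_comm
    _ = ∑ m ∈ range n, ∑ m' ∈ range (D + 1), ∑ n' ∈ range (D + 1), (1 + m' + n' : ℝ) ^ r * |coeffExt (Pc m) m' n'| := sum_comm
    _ = ∑ m ∈ range n, (Pc m).coeffNorm r := sum_congr rfl fun m hm => (coeffNorm_eq_sum_coeffExt (Pc m) (hPD m hm) r).symm
    _ ≤ ∑ m ∈ range n, 4 * (2 * klFlowDeg m + 1) * (1 + 4 * klFlowDeg m) ^ r * δ m := sum_le_sum hpiece

end Data

/-! ## §4 From the V17F2 (rev-2) tower: every order, and the sup form -/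

section Tower

variable {G : GeoConsts} {P : SplitConsts} {Q : EngConsts} {R : RenConsts} {β U μ : ℝ} {K₀ : TrigPolyC4v} {Lstar : ℕ} {Mstar : ℕ → ℕ}

/-- **EVERY ORDER, FROM THE TOWER: `coeffNorm r (K_n^{(L,M)} ⊖ K_n^{(L′,M′)}) ≤ (Σ_{m<n} 4(2d_m+1)(1+4d_m)^r · Q.CL β m)/L`.**
Under `TowerP klPredsV17F2 G P Q R β U μ K₀ Lstar Mstar` (`μ ∈ klWindowC`): for `Lstar ≤ L ≤ L′`, `Mstar L ≤ M`, `Q.M0 β L ≤ M`, `Mstar L′ ≤ M′`,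
`Q.M0 β L′ ≤ M′`, every `n ≤ nScales β + 1` and every order `r`.  Per scale `m < n`, (E3f-F) at `(L, M, m)` with the reader's threshold `Mq := Mstar`
(its history antecedent at every larger volume is the tower itself) gives `sup_θ|ν_m^{(L,M)} − ν_m^{(L′,M′)}| ≤ Q.CL β m / L`, the readings are `C⁴` by
(E3a-F); §3 converts. -/
theorem coeffNorm_fsub_klFlowFrameU_le_of_towerV17F2 (hμ : μ ∈ klWindowC) (hT : TowerP klPredsV17F2 G P Q R β U μ K₀ Lstar Mstar)
    {L : ℕ} [NeZero L] (hL : Lstar ≤ L) {L' : ℕ} [NeZero L'] (hLL' : L ≤ L')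
    {M : ℕ} [NeZero M] (hM₁ : Mstar L ≤ M) (hM₂ : Q.M0 β L ≤ M) {M' : ℕ} [NeZero M'] (hM'₁ : Mstar L' ≤ M') (hM'₂ : Q.M0 β L' ≤ M')
    {n : ℕ} (hn : n ≤ nScales β + 1) (r : ℕ) :
    (fsub (klFlowFrameU L M β U μ n) (klFlowFrameU L' M' β U μ n)).coeffNorm r ≤
      (∑ m ∈ range n, 4 * (2 * klFlowDeg m + 1) * (1 + 4 * klFlowDeg m) ^ r * Q.CL β m) / L := by
  have hL' : Lstar ≤ L' := hL.trans hLL'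
  have hTL := hT L M hL hM₁
  have hTL' := hT L' M' hL' hM'₁
  -- per scale: readings `C⁴` in both volumes and the (E3f-F) rate
  have key : ∀ m < n,
      ContDiff ℝ 4 (fun θ : ℝ => klLocalPart L M β U μ (klFlowFrameU L M β U μ m) m θ) ∧
        ContDiff ℝ 4 (fun θ : ℝ => klLocalPart L' M' β U μ (klFlowFrameU L' M' β U μ m) m θ) ∧
          ∀ θ : ℝ, |klLocalPart L M β U μ (klFlowFrameU L M β U μ m) m θ -
            klLocalPart L' M' β U μ (klFlowFrameU L' M' β U μ m) m θ| ≤ Q.CL β m / L := by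
    intro m hm
    have hm' : m ≤ nScales β := by omega
    have h2 : TwoLegStepV17F2 L M G P Q R β U μ m := (hTL.1 m hm').2.2.2
    have h2' : TwoLegStepV17F2 L' M' G P Q R β U μ m := (hTL'.1 m hm').2.2.2
    obtain ⟨hread, -, hrate⟩ := h2
    obtain ⟨hread', -, -⟩ := h2'
    have hhist : ∀ (L₂ M₂ : ℕ) [NeZero L₂] [NeZero M₂], L ≤ L₂ → Q.M0 β L₂ ≤ M₂ → Mstar L₂ ≤ M₂ →
        ∀ j < m, histV17F2 L₂ M₂ G P Q R β U μ j ∧ TwoLegSlopes L₂ M₂ R β U μ (klFlowFrameU L₂ M₂ β U μ j) j := by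
      intro L₂ M₂ _ _ hL₂ _ hM₂ j hj
      have hj' : j ≤ nScales β := by omega
      obtain ⟨hren, hspl, heng, htwo⟩ := (hT L₂ M₂ (hL.trans hL₂) hM₂).1 j hj'
      have htwo' : TwoLegStepV17F2 L₂ M₂ G P Q R β U μ j := htwo
      exact ⟨⟨hspl, hren, heng, htwo'.1⟩, htwo'.2.1⟩
    exact ⟨hread.1, hread'.1, hrate Mstar hM₂ hM₁ hhist L' M' hLL' hM'₂ hM'₁⟩
  refine (coeffNorm_fsub_klFlowFrameU_le_sum hμ n (fun m hm => (key m hm).1) (fun m hm => (key m hm).2.1)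
    (δ := fun m => Q.CL β m / L) (fun m hm => (key m hm).2.2) r).trans (le_of_eq ?_)
  rw [sum_div]
  exact sum_congr rfl fun m _ => by ring

/-- **Every derivative of the frame difference, from the tower**:
`‖Dʲ evalM (K_n^{(L,M)} ⊖ K_n^{(L′,M′)})(q)‖ ≤ (Σ_{m<n} 4(2d_m+1)(1+4d_m)^j · Q.CL β m)/L` at every `q`. -/
theorem norm_iteratedFDeriv_evalM_fsub_klFlowFrameU_le_of_towerV17F2 (hμ : μ ∈ klWindowC)
    (hT : TowerP klPredsV17F2 G P Q R β U μ K₀ Lstar Mstar)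
    {L : ℕ} [NeZero L] (hL : Lstar ≤ L) {L' : ℕ} [NeZero L'] (hLL' : L ≤ L')
    {M : ℕ} [NeZero M] (hM₁ : Mstar L ≤ M) (hM₂ : Q.M0 β L ≤ M) {M' : ℕ} [NeZero M'] (hM'₁ : Mstar L' ≤ M') (hM'₂ : Q.M0 β L' ≤ M')
    {n : ℕ} (hn : n ≤ nScales β + 1) (j : ℕ) (q : Momentum) :
    ‖iteratedFDeriv ℝ j (evalM (fsub (klFlowFrameU L M β U μ n) (klFlowFrameU L' M' β U μ n))) q‖ ≤
      (∑ m ∈ range n, 4 * (2 * klFlowDeg m + 1) * (1 + 4 * klFlowDeg m) ^ j * Q.CL β m) / L :=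
  (norm_iteratedFDeriv_evalM_le_coeffNorm _ j q).trans (coeffNorm_fsub_klFlowFrameU_le_of_towerV17F2 hμ hT hL hLL' hM₁ hM₂ hM'₁ hM'₂ hn j)

/-- **The same for the difference of the two frame functions on `Momentum`**: `‖Dʲ (evalM K_n^{(L,M)} − evalM K_n^{(L′,M′)})(q)‖ ≤ …/L`. -/
theorem norm_iteratedFDeriv_sub_evalM_klFlowFrameU_le_of_towerV17F2 (hμ : μ ∈ klWindowC)
    (hT : TowerP klPredsV17F2 G P Q R β U μ K₀ Lstar Mstar)
    {L : ℕ} [NeZero L] (hL : Lstar ≤ L) {L' : ℕ} [NeZero L'] (hLL' : L ≤ L')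
    {M : ℕ} [NeZero M] (hM₁ : Mstar L ≤ M) (hM₂ : Q.M0 β L ≤ M) {M' : ℕ} [NeZero M'] (hM'₁ : Mstar L' ≤ M') (hM'₂ : Q.M0 β L' ≤ M')
    {n : ℕ} (hn : n ≤ nScales β + 1) (j : ℕ) (q : Momentum) :
    ‖iteratedFDeriv ℝ j (fun q : Momentum => evalM (klFlowFrameU L M β U μ n) q - evalM (klFlowFrameU L' M' β U μ n) q) q‖ ≤
      (∑ m ∈ range n, 4 * (2 * klFlowDeg m + 1) * (1 + 4 * klFlowDeg m) ^ j * Q.CL β m) / L := by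
  rw [← evalM_fsub_eq]
  exact norm_iteratedFDeriv_evalM_fsub_klFlowFrameU_le_of_towerV17F2 hμ hT hL hLL' hM₁ hM₂ hM'₁ hM'₂ hn j q

/-- **The sup form** (g7's pointwise bound as a `frameDist` statement): `frameDist K_n^{(L,M)} K_n^{(L′,M′)} ≤ (Σ_{m<n} Q.CL β m)/L`. -/
theorem frameDist_klFlowFrameU_le_of_towerV17F2 (hμ : μ ∈ klWindowC) (hT : TowerP klPredsV17F2 G P Q R β U μ K₀ Lstar Mstar)
    {L : ℕ} [NeZero L] (hL : Lstar ≤ L) {L' : ℕ} [NeZero L'] (hLL' : L ≤ L')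
    {M : ℕ} [NeZero M] (hM₁ : Mstar L ≤ M) (hM₂ : Q.M0 β L ≤ M) {M' : ℕ} [NeZero M'] (hM'₁ : Mstar L' ≤ M') (hM'₂ : Q.M0 β L' ≤ M')
    {n : ℕ} (hn : n ≤ nScales β + 1) :
    frameDist (klFlowFrameU L M β U μ n) (klFlowFrameU L' M' β U μ n) ≤ (∑ m ∈ range n, Q.CL β m) / L :=
  ciSup_le fun q => flowFrames_twoVolume_of_towerV17F2 hμ hT hL hLL' hM₁ hM₂ hM'₁ hM'₂ hn q

end Tower

/-! ## §5 Frames along lattice lines: smooth, with `k`-th derivative bounded by `coeffNorm k` (the `UVLineBound` currency) -/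

section Line

/-- The lattice line through `p` in direction `e_l`, as an affine map into `Momentum`, hits `p + t e_l`. -/
theorem eval_line_eq_evalM (A : TrigPolyC4v) (p : Fin 2 → ℝ) (l : Fin 2) (t : ℝ) :
    A.eval (p + t • Pi.single l 1) =
      evalM A (ContinuousLinearMap.toSpanSingleton ℝ (EuclideanSpace.single l (1 : ℝ)) t + WithLp.toLp 2 p) := by
  rw [evalM_apply, ContinuousLinearMap.toSpanSingleton_apply]
  congr 1
  ext i
  simp [Pi.single_apply, add_comm]

/-- **A frame is smooth along every lattice line.** -/
theorem contDiff_eval_line (A : TrigPolyC4v) (p : Fin 2 → ℝ) (l : Fin 2) {k : WithTop ℕ∞} :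
    ContDiff ℝ k (fun t : ℝ => A.eval (p + t • Pi.single l 1)) := by
  have hfun : (fun t : ℝ => A.eval (p + t • Pi.single l 1)) =
      (fun y : Momentum => evalM A (y + WithLp.toLp 2 p)) ∘
        (ContinuousLinearMap.toSpanSingleton ℝ (EuclideanSpace.single l (1 : ℝ))) := by
    funext t; simp only [Function.comp_apply, eval_line_eq_evalM]
  rw [hfun]
  exact ((contDiff_evalM A).comp (contDiff_id.add contDiff_const)).comp (ContinuousLinearMap.contDiff _)

/-- **`|∂ₜᵏ A(p + t e_l)| ≤ coeffNorm k A`** for every frame, base point, lattice direction, order and `t` (the unit-speed line composed with p1b's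
`‖Dᵏ evalM A‖ ≤ coeffNorm k A`). -/
theorem norm_iteratedDeriv_eval_line_le_coeffNorm (A : TrigPolyC4v) (p : Fin 2 → ℝ) (l : Fin 2) (k : ℕ) (t : ℝ) :
    ‖iteratedDeriv k (fun t : ℝ => A.eval (p + t • Pi.single l 1)) t‖ ≤ A.coeffNorm k := by
  set v : Momentum := EuclideanSpace.single l (1 : ℝ) with hv
  set Φ : ℝ →L[ℝ] Momentum := ContinuousLinearMap.toSpanSingleton ℝ v with hΦ
  set Pt : Momentum := WithLp.toLp 2 p with hPt
  set h : Momentum → ℝ := fun y => evalM A (y + Pt) with hh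
  have hhC : ContDiff ℝ k h := (contDiff_evalM A).comp (contDiff_id.add contDiff_const)
  have hfun : (fun t : ℝ => A.eval (p + t • Pi.single l 1)) = h ∘ Φ := by
    funext t; simp only [Function.comp_apply, hh, hΦ, hPt, hv, eval_line_eq_evalM]
  have hΦnorm : ‖Φ‖ ≤ 1 := by
    rw [hΦ, ContinuousLinearMap.norm_toSpanSingleton, hv, PiLp.norm_single, norm_one]
  rw [← norm_iteratedFDeriv_eq_norm_iteratedDeriv, hfun, ContinuousLinearMap.iteratedFDeriv_comp_right Φ hhC t (i := k) le_rfl]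
  refine (ContinuousMultilinearMap.norm_compContinuousLinearMap_le _ _).trans ?_
  have h1 : ‖iteratedFDeriv ℝ k h (Φ t)‖ ≤ A.coeffNorm k := by
    rw [hh, iteratedFDeriv_comp_add_right k Pt (Φ t)]
    exact norm_iteratedFDeriv_evalM_le_coeffNorm A k _
  have h2 : ∏ _i : Fin k, ‖Φ‖ ≤ 1 := prod_le_one (fun _ _ => norm_nonneg _) fun _ _ => hΦnorm
  calc ‖iteratedFDeriv ℝ k h (Φ t)‖ * ∏ _i : Fin k, ‖Φ‖ ≤ A.coeffNorm k * 1 :=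
        mul_le_mul h1 h2 (by positivity) (TrigPolyC4v.coeffNorm_nonneg _ _)
    _ = A.coeffNorm k := mul_one _

/-- The line derivative of a DIFFERENCE of frames: `|∂ₜᵏ (A − B)(p + t e_l)| ≤ coeffNorm k (A ⊖ B)`. -/
theorem norm_iteratedDeriv_eval_sub_line_le_coeffNorm (A B : TrigPolyC4v) (p : Fin 2 → ℝ) (l : Fin 2) (k : ℕ) (t : ℝ) :
    ‖iteratedDeriv k (fun t : ℝ => A.eval (p + t • Pi.single l 1) - B.eval (p + t • Pi.single l 1)) t‖ ≤ (fsub A B).coeffNorm k := by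
  have hfun : (fun t : ℝ => A.eval (p + t • Pi.single l 1) - B.eval (p + t • Pi.single l 1)) =
      fun t : ℝ => (fsub A B).eval (p + t • Pi.single l 1) := by
    funext t; rw [eval_fsub]
  rw [hfun]
  exact norm_iteratedDeriv_eval_line_le_coeffNorm (fsub A B) p l k t

variable {G : GeoConsts} {P : SplitConsts} {Q : EngConsts} {R : RenConsts} {β U μ : ℝ} {K₀ : TrigPolyC4v} {Lstar : ℕ} {Mstar : ℕ → ℕ}

/-- **Two volumes' flow-frame bands along lattice lines, every order, from the tower**: for `Lstar ≤ L ≤ L′` (thresholds as in §4), `n ≤ nScales β + 1`,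
every base point `p`, direction `l`, order `k` and `t`,
`|∂ₜᵏ (K_n^{(L,M)} − K_n^{(L′,M′)})(p + t e_l)| ≤ (Σ_{m<n} 4(2d_m+1)(1+4d_m)^k · Q.CL β m)/L` — the band difference `e_{K} − e_{K′} = −(K − K′)` of the
symbol-difference covariance step has all its line jets `O_k(1)/L`. -/
theorem abs_iteratedDeriv_line_klFlowFrameU_sub_le_of_towerV17F2 (hμ : μ ∈ klWindowC) (hT : TowerP klPredsV17F2 G P Q R β U μ K₀ Lstar Mstar)
    {L : ℕ} [NeZero L] (hL : Lstar ≤ L) {L' : ℕ} [NeZero L'] (hLL' : L ≤ L')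
    {M : ℕ} [NeZero M] (hM₁ : Mstar L ≤ M) (hM₂ : Q.M0 β L ≤ M) {M' : ℕ} [NeZero M'] (hM'₁ : Mstar L' ≤ M') (hM'₂ : Q.M0 β L' ≤ M')
    {n : ℕ} (hn : n ≤ nScales β + 1) (p : Fin 2 → ℝ) (l : Fin 2) (k : ℕ) (t : ℝ) :
    |iteratedDeriv k (fun t : ℝ => (klFlowFrameU L M β U μ n).eval (p + t • Pi.single l 1) -
        (klFlowFrameU L' M' β U μ n).eval (p + t • Pi.single l 1)) t| ≤
      (∑ m ∈ range n, 4 * (2 * klFlowDeg m + 1) * (1 + 4 * klFlowDeg m) ^ k * Q.CL β m) / L := by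
  rw [← Real.norm_eq_abs]
  exact (norm_iteratedDeriv_eval_sub_line_le_coeffNorm _ _ p l k t).trans
    (coeffNorm_fsub_klFlowFrameU_le_of_towerV17F2 hμ hT hL hLL' hM₁ hM₂ hM'₁ hM'₂ hn k)

end Line

end Summit.HubbardSuperconductivity.HubbardSuperconductivity.Theorems.TwoPointAssembly

end
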